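import Literature.MathematicalPhysics.QuantumFieldTheory.Balaban1983to89.B11Eq90V0primeBond

/-!
# `Balaban1983to89.B11Eq94CommutatorBond` — T. Bałaban, *The variational problem and background fields in renormalization group method for lattice gauge theories*, Commun. Math. Phys. **102** (1985) 277–309 [Balaban1983to89 / Balaban1985Variational]: (91)–(96) p. 292 ON [5]'s ABSTRACT LATTICE — the commutator group of `(δ/δA′)V` (the first member `½ i tr((DA)(p) Σ_{b₁≺b₂}[A′(b₁), A′(b₂)])` of (39)): the (94)-type decomposition of the commutator field, the covariant Leibniz rule (96), the «simple difference operation» bound for `D*` of the commutator field, — the pointwise part of the commutator group, `O(1)(|∇A′||A′| + η|∇A′|²)` with no `η⁻¹|A′|²` (the one-bond functional, its (92) split, the bond-local integration by parts (92)→(93) and its operator norm are the sequel `B11Eq92CommutatorFunctional`)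

statement-level skeleton of published theorems with citation tags; proofs where landed; nothing here is a claim about the Yang–Mills mass gap

PDF held: `paper:balaban1985-cmp102-variational-background` (journal page = PDF page + 276); p. 292 read by this seat from the `lit read` text layer;
(91)–(96) as transcribed (render-read) in `B11Eq93Commutator` (r08), whose ℤ^d-model certificate of the same passage this file parallels on the
carrier that the (115) letters use.

CITATION HEADER (lean-in-tree rule 2026-08-18).  WHAT IS REPRODUCED: row `B11.Eq85`'s last group (p. 292 from «Let us consider the terms with the
derivative acting on A′» to «can be estimated by O(1)|∇A′||A′| also»), for the term of (39)/(91) WITHOUT `HD(A′)` insertions, on [5]'s abstract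
finite lattice of `B9Eq39Adjoint` (sites `S`, directions `ι`, bijective shifts `T`, background units `U`) — the carrier of the (L3) line
(`B11Eq90V0primeBond`, `B11Eq90V0primeCurrent`).  THE PRINT, verbatim (p. 292): *«A typical term is Σ_{p∈Ω₀} η^d ½ tr(DA′)(p) Σ_{b₁≺b₂} i[A″(b₁),
A″(b₂)] = ½⟨DA′, Σi[A″, A″]⟩, (91) … The functional differentiation gives three terms ½⟨DδA′, Σi[A″, A″]⟩ + ½⟨DA′, Σi([δA″, A″] + [A″, δA″])⟩, (92)
and the functional derivatives connected with the second and third terms are estimated easily by O(1)|DA′||A′|. We transform the first term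
integrating by parts, and we get the functional derivative given by ½D*Σi[A″, A″]. (93) … Σ_{b₁≺b₂} i[A″(b₁), A″(b₂)] = 2i[A′_μ(x), A′_ν(x)] +
2iη[…] … (94) If we apply the derivative D* to all the terms on the right-hand side of the above equation except the first, then we can use the
factor η to replace this derivative by a simple difference operation. Thus these terms in (93) can be estimated by O(1)|∇A′||A′|. … (D*_ν[A′_μ,
A′_ν])(x) = η[(D*_νA′_μ)(x), (D*_νA′_ν)(x)] + [(D*_νA′_μ)(x), A′_ν(x)] + [A′_μ(x), (D*_νA′_ν)(x)]. (96) From this it follows that the expression (95)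
can be estimated by O(1)|∇A′||A′| also.»*

WHY THIS FILE (cell context).  The V₀-term of (80) contributes `W₄` (the V′₀-group, (90)) + `W₅` (this commutator group) to the letter (L3)
`W = (δ/δA′)V` of the pub-balaban NE9 letter map; gen 64's `B11Eq90V0primeCurrent` types `W₄` at the carrier.  `W₅` needs the (91)–(96) estimates
ON THE SAME CARRIER (r08's `B11Eq93Commutator` proves them on the ℤ^d `Site d` model of [6]); this file supplies them on [5]'s abstract lattice,
with the letters of `B9Eq39Adjoint` (`covD`, `covDstar`, `curl`, `divP`, `lettersA`, `R`) and in the SHAPE the carrier assembly consumes: the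
operator norm of `Σ_{p∈st(b)} (∂/∂A(b)) term39(A, ∂p)` bounded by `‖τ‖(½η⁻¹‖(D¹*Σ[A′,A′])(b)‖ + 16(d − 1)·G₂·s)` with `‖(D¹*Σ[A′,A′])(b)‖ ≦
(d − 1)(16an + 4n²)` (`a` = letters, `n = η|∇A|`, `G₂ = |(D^ηA)(p)|`, `s = |A|(∂p)`) — i.e. `O(1)(|∇A||A| + η|∇A|²)` after the `η⁻¹`.

WHAT IS DEFINED AND PROVED (sorry-free; axioms `propext` / `Classical.choice` / `Quot.sound`; plumbing defs `comm2F`, `nab`; no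
`Prop`-valued definition, no new named fact).
§1 `comm2F T U A μ ν x` (= `Σ_{b₁≺b₂}[A′(b₁), A′(b₂)]` of the four letters of `∂p`; `B11Eq90V0primeBond.term39 = ½ i τ(curlη · comm2F)`, `term39_eq_comm2F`),
   `nab T U A μ ν x` (= `R(U_μ(x))A_ν(x + e_μ) − A_ν(x) = η(∇_μA_ν)(x)`, the unit-lattice (3.3)), **`comm2F_eq`** — THE (94)-TYPE DECOMPOSITION in
   r08's letter conventions: `Σ_{b₁≺b₂}[A′(b₁),A′(b₂)] = 2[A_μ(x), A_ν(x)] + [A_μ(x), ∇¹_νA_μ(x)] + [∇¹_μA_ν(x), A_ν(x)] − [∇¹_νA_μ(x), ∇¹_μA_ν(x)]`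
   (print's (94) in [6]'s conventions has the same structure: the main term `2[A′_μ, A′_ν]` plus `η`-terms each carrying a covariant derivative);
   `covDstar_mul`, **`covDstar_lie`** (= (96): the covariant Leibniz rule `D*_ν[f, g](x) = [D*_νf(x), R⁻¹g(x − e_ν)] + [f(x), D*_νg(x)]`),
   **`covDstar_component`** (`D¹*_νA_κ(x) = −R(U_ν(x − e_ν))⁻¹(∇¹_νA_κ)(x − e_ν)`).
§2 `B11Eq37NormBound.norm_lie_le`, `norm_comm2F_sub_main_le` (the `η`-terms: `≦ 4an + 2n²`), **`norm_covDstar_comm2F_le`** — «use the factor η to replace this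
   derivative by a simple difference operation» + (96): `‖D¹*_ν(Σ[A′,A′])(x)‖ ≦ 16an + 4n²` (unit-ball transports), **`norm_divP_comm2F_le`**:
   `‖(D¹*Σ[A′,A′])_μ(x)‖ ≦ (|ι| − 1)(16an + 4n²)` under letter/derivative majorants `a`, `n` on the plaquette star of `b = (x, μ)`.
(§3 — the one-bond functional `dTerm39Bond`, the split (92), Cauchy for the «second and third terms», the bond-local integration by parts and
   the operator norm of the summed functional — is the sequel `B11Eq92CommutatorFunctional`.)

HONEST SCOPE — what is NOT claimed.  (i) [5]'s abstract carrier (DIVERGENCE D-pv27.4 inherited); r08's letter conventions (`lettersA`), so the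
coefficients of the (94)-type identity differ from print's (94) (which uses [6]'s `A″` conventions) — the STRUCTURE «main term + η·(terms with a
covariant derivative)» and the resulting `O(1)|∇A′||A′|` bound are print's; (95) (the antisymmetrised form) is not separately displayed (it is
`divP`'s definition, `B9Eq39Adjoint.divP`).  (ii) «the other terms … obtained by replacing some A′ in the commutator by −HD(A′)» are NOT modelled
(they need Sect. C's `H`, `D`).  (iii) Hypotheses: unit-ball transports `‖U(b)‖, ‖U(b)⁻¹‖ ≦ 1`, tracial `τ` (for the integration by parts); the
majorants `a`, `n`, `s`, `G₂`, `D` are letters (instantiated from the (115) weights in the carrier sequel).  (iv) Constants `16`, `4`, `½` are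
witnesses of print's O(1).  (v) NOT summit progress (cell pub-balaban: NE9 NOT PRINTED / NOT PROVED; spine PROVED 0/9).  Unit
`b2b-balaban-t4-ne9-formalise-leaf-05` (NE9 crux-team leaf prover, gen 64; the (L3) line's commutator-group file).  Imports `B11Eq90V0primeBond` ONLY.
-/

noncomputable section

open NormedSpace Complex Metric Set Finset Filter Topology

namespace Literature.MathematicalPhysics.QuantumFieldTheory.Balaban1983to89.B11Eq94CommutatorBond

open Literature.MathematicalPhysics.QuantumFieldTheory.Balaban1983to89.Beta.TransportVertices
open Literature.MathematicalPhysics.QuantumFieldTheory.Balaban1983to89.B9Eq37Insertion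
open Literature.MathematicalPhysics.QuantumFieldTheory.Balaban1983to89.B9Eq39Adjoint
open Literature.MathematicalPhysics.QuantumFieldTheory.Balaban1983to89.B11Eq26ActionExpansion
open Literature.MathematicalPhysics.QuantumFieldTheory.Balaban1983to89.B11Eq90V0Derivative
open Literature.MathematicalPhysics.QuantumFieldTheory.Balaban1983to89.B11Eq90StB
open Literature.MathematicalPhysics.QuantumFieldTheory.Balaban1983to89.B11Eq90V0primeBond

/-! ## §1 The commutator field, its (94)-type decomposition, the covariant Leibniz rule (96) -/

section Algebra

variable {𝔸 : Type*} [Ring 𝔸]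
variable {S : Type*} {ι : Type*}
variable (T : ι → Equiv.Perm S) (U : ι → S → 𝔸ˣ)

/-- **`Σ_{b₁≺b₂}[A′(b₁), A′(b₂)]`** — the commutator field of the plaquette `p_{μν}(x)` on the four transported letters of `∂p`
(`B11Eq34BCH.comm2` at `B9Eq39Adjoint.lettersA`; the field inside (39)/(91)). [cite: Balaban1985Variational, (91) p.292, (39) p.284] -/
def comm2F (A : ι → S → 𝔸) (μ ν : ι) (x : S) : 𝔸 :=
  B11Eq34BCH.comm2 (-(R (U ν x) (A μ (T ν x)))) (-(A ν x)) (A μ x) (R (U μ x) (A ν (T μ x)))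

/-- **The unit-lattice covariant derivative of a bond component**: `(∇¹_μA_ν)(x) = R(U_μ(x))A_ν(x + e_μ) − A_ν(x)` (= `η·(∇_μA_ν)(x)` of (3.3);
= `B11Eq111FrakG.nabla115` without its `η⁻¹` under the torus bridge). [cite: Balaban1985BackgroundPropagators, (3.3) p.391] -/
def nab (A : ι → S → 𝔸) (μ ν : ι) (x : S) : 𝔸 := R (U μ x) (A ν (T μ x)) - A ν x

/-- **THE (94)-TYPE DECOMPOSITION** (r08's letter conventions): with `a = A_μ(x)`, `b = A_ν(x)`, `p = ∇¹_μA_ν(x)`, `q = ∇¹_νA_μ(x)`,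
`Σ_{b₁≺b₂}[A′(b₁),A′(b₂)] = 2[a, b] + [a, q] + [p, b] − [q, p]` — the main term `2[A′_μ(x), A′_ν(x)]` plus terms each carrying a covariant
derivative (print's (94), in [6]'s `A″` conventions, has the same structure with other coefficients). [cite: Balaban1985Variational, (94) p.292] -/
theorem comm2F_eq (A : ι → S → 𝔸) (μ ν : ι) (x : S) :
    comm2F T U A μ ν x = 2 • ⁅A μ x, A ν x⁆ + ⁅A μ x, nab T U A ν μ x⁆ + ⁅nab T U A μ ν x, A ν x⁆
      - ⁅nab T U A ν μ x, nab T U A μ ν x⁆ := by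
  have h1 : R (U ν x) (A μ (T ν x)) = A μ x + nab T U A ν μ x := by simp [nab]
  have h4 : R (U μ x) (A ν (T μ x)) = A ν x + nab T U A μ ν x := by simp [nab]
  simp only [comm2F, B11Eq34BCH.comm2, h1, h4, Ring.lie_def]
  noncomm_ring

/-- The transport is multiplicative: `R(V)(XY) = R(V)X·R(V)Y` (`B9Eq39Adjoint.R_mul_R`). [cite: Balaban1985BackgroundPropagators, p.390] -/
theorem R_mul' (V : 𝔸ˣ) (X Y : 𝔸) : R V (X * Y) = R V X * R V Y := (R_mul_R V X Y).symm

/-- The covariant Leibniz rule for `D¹*_ν` of a product of site functions: `D*_ν(fg)(x) = (D*_νf)(x)·R⁻¹g(y) + f(x)·(D*_νg)(x)`, `y = x − e_ν`.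
[cite: Balaban1985Variational, (96) p.292] -/
theorem covDstar_mul (ν : ι) (f g : S → 𝔸) (x : S) :
    covDstar T U ν (fun y => f y * g y) x
      = covDstar T U ν f x * R (U ν ((T ν).symm x))⁻¹ (g ((T ν).symm x)) + f x * covDstar T U ν g x := by
  simp only [covDstar, R_mul']
  noncomm_ring

/-- **(96)**: `D*_ν[f, g](x) = [D*_νf(x), R⁻¹g(x − e_ν)] + [f(x), D*_νg(x)]` (print's `(D*_ν[A′_μ, A′_ν])(x) = η[(D*_νA′_μ), (D*_νA′_ν)] +
[(D*_νA′_μ)(x), A′_ν(x)] + [A′_μ(x), (D*_νA′_ν)(x)]`, with `R⁻¹g(x − e_ν) = g(x) + ηD*_νg(x)` folded). [cite: Balaban1985Variational, (96) p.292] -/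
theorem covDstar_lie (ν : ι) (f g : S → 𝔸) (x : S) :
    covDstar T U ν (fun y => ⁅f y, g y⁆) x
      = ⁅covDstar T U ν f x, R (U ν ((T ν).symm x))⁻¹ (g ((T ν).symm x))⁆ + ⁅f x, covDstar T U ν g x⁆ := by
  simp only [covDstar, Ring.lie_def, R_mul', R_sub]
  noncomm_ring

/-- **`D¹*_ν` of a bond component is a transported covariant derivative**: `D¹*_νA_κ(x) = −R(U_ν(y))⁻¹(∇¹_νA_κ)(y)`, `y = x − e_ν` (so it is
`η|∇A|`-small). [cite: Balaban1985BackgroundPropagators, (3.8) p.392] -/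
theorem covDstar_component (ν κ : ι) (A : ι → S → 𝔸) (x : S) :
    covDstar T U ν (A κ) x = -R (U ν ((T ν).symm x))⁻¹ (nab T U A ν κ ((T ν).symm x)) := by
  rw [covDstar, nab, R_sub, ← B9Eq39Adjoint.R_mul, inv_mul_cancel, Equiv.apply_symm_apply, neg_sub]
  simp [R]

end Algebra

/-! ## §2 «A simple difference operation»: the bound for `D¹*` of the commutator field -/

section Bounds

variable {𝔸 : Type*} [NormedRing 𝔸]
variable {S : Type*} {ι : Type*}
variable (T : ι → Equiv.Perm S) (U : ι → S → 𝔸ˣ)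

/-- The `η`-terms of the (94)-type decomposition: `‖Σ[A′,A′] − 2[A_μ, A_ν]‖ ≦ 4an + 2n²` for `‖A_μ(x)‖, ‖A_ν(x)‖ ≦ a`, `‖∇¹‖ ≦ n`.
[cite: Balaban1985Variational, (94) p.292] -/
theorem norm_comm2F_sub_main_le (A : ι → S → 𝔸) (μ ν : ι) (x : S) {a n : ℝ} (ha0 : 0 ≤ a) (hn0 : 0 ≤ n)
    (haμ : ‖A μ x‖ ≤ a) (haν : ‖A ν x‖ ≤ a) (hp : ‖nab T U A μ ν x‖ ≤ n) (hq : ‖nab T U A ν μ x‖ ≤ n) :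
    ‖comm2F T U A μ ν x - 2 • ⁅A μ x, A ν x⁆‖ ≤ 4 * a * n + 2 * n ^ 2 := by
  rw [comm2F_eq]
  have e : 2 • ⁅A μ x, A ν x⁆ + ⁅A μ x, nab T U A ν μ x⁆ + ⁅nab T U A μ ν x, A ν x⁆
      - ⁅nab T U A ν μ x, nab T U A μ ν x⁆ - 2 • ⁅A μ x, A ν x⁆
      = ⁅A μ x, nab T U A ν μ x⁆ + ⁅nab T U A μ ν x, A ν x⁆ - ⁅nab T U A ν μ x, nab T U A μ ν x⁆ := by abel
  rw [e]
  have h1 := B11Eq37NormBound.norm_lie_le (A μ x) (nab T U A ν μ x)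
  have h2 := B11Eq37NormBound.norm_lie_le (nab T U A μ ν x) (A ν x)
  have h3 := B11Eq37NormBound.norm_lie_le (nab T U A ν μ x) (nab T U A μ ν x)
  calc _ ≤ ‖⁅A μ x, nab T U A ν μ x⁆ + ⁅nab T U A μ ν x, A ν x⁆‖ + ‖⁅nab T U A ν μ x, nab T U A μ ν x⁆‖ := norm_sub_le _ _
    _ ≤ ‖⁅A μ x, nab T U A ν μ x⁆‖ + ‖⁅nab T U A μ ν x, A ν x⁆‖ + ‖⁅nab T U A ν μ x, nab T U A μ ν x⁆‖ := by
        gcongr; exact norm_add_le _ _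
    _ ≤ 2 * a * n + 2 * n * a + 2 * n * n := by
        gcongr
        · exact h1.trans (by gcongr)
        · exact h2.trans (by gcongr)
        · exact h3.trans (by gcongr)
    _ = 4 * a * n + 2 * n ^ 2 := by ring

variable [NormOneClass 𝔸]

/-- **`D¹*_ν` OF THE COMMUTATOR FIELD IS `O(|∇A||A| + |∇¹|²)`**: «use the factor η to replace this derivative by a simple difference operation» for
the `η`-terms and the Leibniz rule (96) for the main term — `‖D¹*_ν(Σ[A′,A′])(x)‖ ≦ 16an + 4n²` under letter majorants `a` and derivative
majorants `n` at `x` and `x − e_ν` (unit-ball transports). [cite: Balaban1985Variational, (94)–(96) p.292] -/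
theorem norm_covDstar_comm2F_le (hUn : ∀ μ x, ‖(U μ x : 𝔸)‖ ≤ 1 ∧ ‖(((U μ x)⁻¹ : 𝔸ˣ) : 𝔸)‖ ≤ 1)
    (A : ι → S → 𝔸) (ν μ' ν' : ι) (x : S) {a n : ℝ} (ha0 : 0 ≤ a) (hn0 : 0 ≤ n)
    (hax : ‖A μ' x‖ ≤ a ∧ ‖A ν' x‖ ≤ a) (hay : ‖A μ' ((T ν).symm x)‖ ≤ a ∧ ‖A ν' ((T ν).symm x)‖ ≤ a)
    (hnx : ‖nab T U A μ' ν' x‖ ≤ n ∧ ‖nab T U A ν' μ' x‖ ≤ n)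
    (hny : ‖nab T U A μ' ν' ((T ν).symm x)‖ ≤ n ∧ ‖nab T U A ν' μ' ((T ν).symm x)‖ ≤ n)
    (hnν : ‖nab T U A ν μ' ((T ν).symm x)‖ ≤ n ∧ ‖nab T U A ν ν' ((T ν).symm x)‖ ≤ n) :
    ‖covDstar T U ν (fun y => comm2F T U A μ' ν' y) x‖ ≤ 16 * a * n + 4 * n ^ 2 := by
  set y := (T ν).symm x with hy
  have hRinv : ∀ Z : 𝔸, ‖R (U ν y)⁻¹ Z‖ ≤ ‖Z‖ := fun Z =>
    norm_R_le (by simpa using (hUn ν y).2) (by simpa using (hUn ν y).1) Z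
  have hsplit : covDstar T U ν (fun y => comm2F T U A μ' ν' y) x
      = covDstar T U ν (fun y => (2 : ℤ) • ⁅A μ' y, A ν' y⁆) x
        + covDstar T U ν (fun y => comm2F T U A μ' ν' y - (2 : ℤ) • ⁅A μ' y, A ν' y⁆) x := by
    rw [← covDstar_add]; congr 1; funext z; simp
  rw [hsplit]
  have hmain : ‖covDstar T U ν (fun y => (2 : ℤ) • ⁅A μ' y, A ν' y⁆) x‖ ≤ 8 * a * n := by
    have e : (fun y => (2 : ℤ) • ⁅A μ' y, A ν' y⁆) = fun y => ⁅A μ' y, A ν' y⁆ + ⁅A μ' y, A ν' y⁆ := by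
      funext z; rw [two_zsmul]
    rw [e, show (fun y => ⁅A μ' y, A ν' y⁆ + ⁅A μ' y, A ν' y⁆) = (fun y => ⁅A μ' y, A ν' y⁆) + (fun y => ⁅A μ' y, A ν' y⁆)
      from rfl, covDstar_add]
    have hL : ‖covDstar T U ν (fun y => ⁅A μ' y, A ν' y⁆) x‖ ≤ 4 * a * n := by
      rw [covDstar_lie, covDstar_component, covDstar_component]
      calc _ ≤ ‖⁅-R (U ν y)⁻¹ (nab T U A ν μ' y), R (U ν y)⁻¹ (A ν' y)⁆‖ + ‖⁅A μ' x, -R (U ν y)⁻¹ (nab T U A ν ν' y)⁆‖ :=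
            norm_add_le _ _
        _ ≤ 2 * n * a + 2 * a * n := by
            have h1 : ‖-R (U ν y)⁻¹ (nab T U A ν μ' y)‖ ≤ n := by rw [norm_neg]; exact (hRinv _).trans hnν.1
            have h2 : ‖R (U ν y)⁻¹ (A ν' y)‖ ≤ a := (hRinv _).trans hay.2
            have h3 : ‖-R (U ν y)⁻¹ (nab T U A ν ν' y)‖ ≤ n := by rw [norm_neg]; exact (hRinv _).trans hnν.2
            gcongr
            · exact (B11Eq37NormBound.norm_lie_le _ _).trans (by gcongr)
            · exact (B11Eq37NormBound.norm_lie_le _ _).trans (by gcongr; exact hax.1)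
        _ = 4 * a * n := by ring
    calc _ ≤ ‖covDstar T U ν (fun y => ⁅A μ' y, A ν' y⁆) x‖ + ‖covDstar T U ν (fun y => ⁅A μ' y, A ν' y⁆) x‖ :=
          norm_add_le _ _
      _ ≤ 4 * a * n + 4 * a * n := add_le_add hL hL
      _ = 8 * a * n := by ring
  have hE : ‖covDstar T U ν (fun y => comm2F T U A μ' ν' y - (2 : ℤ) • ⁅A μ' y, A ν' y⁆) x‖ ≤ 2 * (4 * a * n + 2 * n ^ 2) := by
    rw [covDstar]
    have ex : ‖comm2F T U A μ' ν' x - (2 : ℤ) • ⁅A μ' x, A ν' x⁆‖ ≤ 4 * a * n + 2 * n ^ 2 := by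
      simpa using norm_comm2F_sub_main_le T U A μ' ν' x ha0 hn0 hax.1 hax.2 hnx.1 hnx.2
    have ey : ‖R (U ν y)⁻¹ (comm2F T U A μ' ν' y - (2 : ℤ) • ⁅A μ' y, A ν' y⁆)‖ ≤ 4 * a * n + 2 * n ^ 2 :=
      (hRinv _).trans (by simpa using norm_comm2F_sub_main_le T U A μ' ν' y ha0 hn0 hay.1 hay.2 hny.1 hny.2)
    calc _ ≤ _ := norm_sub_le _ _
      _ ≤ (4 * a * n + 2 * n ^ 2) + (4 * a * n + 2 * n ^ 2) := add_le_add ey ex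
      _ = 2 * (4 * a * n + 2 * n ^ 2) := by ring
  calc _ ≤ _ := norm_add_le _ _
    _ ≤ 8 * a * n + 2 * (4 * a * n + 2 * n ^ 2) := add_le_add hmain hE
    _ = 16 * a * n + 4 * n ^ 2 := by ring

variable [Fintype ι] [LinearOrder ι]

/-- **`‖(D¹*Σ[A′,A′])_μ(x)‖ ≦ (|ι| − 1)(16an + 4n²)`** — (93)/(95) summed over the directions `ν ≠ μ`, under letter/derivative majorants on the
plaquette star of the bond `(x, μ)` (sites `x` and `x − e_ν`, components `μ, ν`). [cite: Balaban1985Variational, (93)–(96) p.292] -/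
theorem norm_divP_comm2F_le (hUn : ∀ μ x, ‖(U μ x : 𝔸)‖ ≤ 1 ∧ ‖(((U μ x)⁻¹ : 𝔸ˣ) : 𝔸)‖ ≤ 1)
    (A : ι → S → 𝔸) (μ : ι) (x : S) {a n : ℝ} (ha0 : 0 ≤ a) (hn0 : 0 ≤ n)
    (ha : ∀ ν : ι, ∀ y : S, (y = x ∨ y = (T ν).symm x) → ‖A μ y‖ ≤ a ∧ ‖A ν y‖ ≤ a)
    (hn : ∀ ν : ι, ∀ y : S, (y = x ∨ y = (T ν).symm x) → ∀ κ κ' : ι, (κ = μ ∨ κ = ν) → (κ' = μ ∨ κ' = ν) →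
      ‖nab T U A κ κ' y‖ ≤ n) :
    ‖divP T U (comm2F T U A) μ x‖ ≤ (Fintype.card ι - 1 : ℕ) * (16 * a * n + 4 * n ^ 2) := by
  set B : ℝ := 16 * a * n + 4 * n ^ 2 with hB
  have hB0 : 0 ≤ B := by positivity
  have hterm : ∀ ν : ι,
      ‖(if ν < μ then covDstar T U ν (comm2F T U A ν μ) x else 0)
        - (if μ < ν then covDstar T U ν (comm2F T U A μ ν) x else 0)‖ ≤ if ν = μ then 0 else B := by
    intro ν
    by_cases hνμ : ν = μ
    · subst hνμ; simp
    rw [if_neg hνμ]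
    rcases lt_or_gt_of_ne hνμ with hlt | hgt
    · rw [if_pos hlt, if_neg (lt_asymm hlt), sub_zero]
      exact norm_covDstar_comm2F_le T U hUn A ν ν μ x ha0 hn0
        ⟨(ha ν x (Or.inl rfl)).2, (ha ν x (Or.inl rfl)).1⟩
        ⟨(ha ν _ (Or.inr rfl)).2, (ha ν _ (Or.inr rfl)).1⟩
        ⟨hn ν x (Or.inl rfl) ν μ (Or.inr rfl) (Or.inl rfl), hn ν x (Or.inl rfl) μ ν (Or.inl rfl) (Or.inr rfl)⟩
        ⟨hn ν _ (Or.inr rfl) ν μ (Or.inr rfl) (Or.inl rfl), hn ν _ (Or.inr rfl) μ ν (Or.inl rfl) (Or.inr rfl)⟩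
        ⟨hn ν _ (Or.inr rfl) ν ν (Or.inr rfl) (Or.inr rfl), hn ν _ (Or.inr rfl) ν μ (Or.inr rfl) (Or.inl rfl)⟩
    · rw [if_neg (lt_asymm hgt), if_pos hgt, zero_sub, norm_neg]
      exact norm_covDstar_comm2F_le T U hUn A ν μ ν x ha0 hn0
        ⟨(ha ν x (Or.inl rfl)).1, (ha ν x (Or.inl rfl)).2⟩
        ⟨(ha ν _ (Or.inr rfl)).1, (ha ν _ (Or.inr rfl)).2⟩
        ⟨hn ν x (Or.inl rfl) μ ν (Or.inl rfl) (Or.inr rfl), hn ν x (Or.inl rfl) ν μ (Or.inr rfl) (Or.inl rfl)⟩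
        ⟨hn ν _ (Or.inr rfl) μ ν (Or.inl rfl) (Or.inr rfl), hn ν _ (Or.inr rfl) ν μ (Or.inr rfl) (Or.inl rfl)⟩
        ⟨hn ν _ (Or.inr rfl) ν μ (Or.inr rfl) (Or.inl rfl), hn ν _ (Or.inr rfl) ν ν (Or.inr rfl) (Or.inr rfl)⟩
  rw [divP, ← Finset.sum_sub_distrib]
  calc _ ≤ ∑ ν, ‖(if ν < μ then covDstar T U ν (comm2F T U A ν μ) x else 0)
        - (if μ < ν then covDstar T U ν (comm2F T U A μ ν) x else 0)‖ := norm_sum_le _ _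
    _ ≤ ∑ ν, (if ν = μ then 0 else B) := Finset.sum_le_sum fun ν _ => hterm ν
    _ = (Fintype.card ι - 1 : ℕ) * B := by
        rw [Finset.sum_ite, Finset.sum_const_zero, zero_add, Finset.sum_const, nsmul_eq_mul,
          Finset.filter_ne' Finset.univ μ, Finset.card_erase_of_mem (Finset.mem_univ _), Finset.card_univ]

end Bounds

end Literature.MathematicalPhysics.QuantumFieldTheory.Balaban1983to89.B11Eq94CommutatorBond

end
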